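import Mathlib
import HarnessLib
import Summits.AtomisticToContinuum.Crystallization.Theorems.PricedLinkCensusSoftFourRingsHexagon4
import Summits.AtomisticToContinuum.Crystallization.Theorems.PricedLinkCensusSoftFourRingsCube4
import Summits.AtomisticToContinuum.Crystallization.Theorems.PricedLinkCensusSoftFourRingsLabelling

/-!
# Soft four-rings, endgame (E): the bond graph is the cuboctahedron or the anticuboctahedron

Route `PricedLinkCensus`, sub-problem `Crystallization`, item `SoftFourRings`
(stmt-AtomisticToContinuum-14234): the COMBINATORIAL ENDGAME of the evidence file (§12.8).  In the
hull-level setting of the twelve-point reduction (`hull_setting_of_twelve`), conditional on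
Tammes-13, the bond graph of the twelve directions is — as a labelled graph — the FCC contact
graph `fccAdj` (cuboctahedron) or the HCP contact graph `hcpAdj` (anticuboctahedron) of
`Literature/…/KissingRigidity`:

* `bond_graph_fcc_or_hcp` : `∃ p : Fin 12 → ℝ³` injective with values in `X` such that
  `{p i, p j} ∈ B ↔ fccAdj i j` for all `i, j`, or `{p i, p j} ∈ B ↔ hcpAdj i j` for all `i, j`.

This reduces `EndgameRigidity` (`PricedLinkCensusSoftFourRingsDefs`) to the purely metric
rigidity of the two labelled frameworks at one percent.
-/

namespace Summit.AtomisticToContinuum.Crystallization.Theorems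

open Real RealInnerProductSpace Literature.Geometry.DiscreteGeometry

/-- Injectivity of a `![…]` of twelve entries from `List.Nodup`. -/
theorem injective_vec12 {α : Type*} {x0 x1 x2 x3 x4 x5 x6 x7 x8 x9 x10 x11 : α}
    (h : [x0, x1, x2, x3, x4, x5, x6, x7, x8, x9, x10, x11].Nodup) :
    Function.Injective ![x0, x1, x2, x3, x4, x5, x6, x7, x8, x9, x10, x11] := by
  have hinj := List.nodup_iff_injective_get.1 h
  intro i j hij
  have key : ∀ k : Fin 12, ![x0, x1, x2, x3, x4, x5, x6, x7, x8, x9, x10, x11] k =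
      [x0, x1, x2, x3, x4, x5, x6, x7, x8, x9, x10, x11].get (k.cast rfl) := by
    intro k; fin_cases k <;> rfl
  rw [key, key] at hij
  exact Fin.cast_injective _ (hinj hij)

section Setting

variable {X : Finset (EuclideanSpace ℝ (Fin 3))} {B : Finset (Finset (EuclideanSpace ℝ (Fin 3)))}
  (hT : musinTarasov2012_tammes_thirteen) (hX1 : ∀ y ∈ X, ‖y‖ = 1) (hcard : X.card = 12)
  (hsepX : ∀ u ∈ X, ∀ u' ∈ X, u ≠ u' → ⟪u, u'⟫ ≤ 1 - 1 / (2 * (101 / 100 : ℝ) ^ 2))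
  (hB : ∀ T ∈ B, ∃ u ∈ X, ∃ u' ∈ X, u ≠ u' ∧ 1 - (101 / 100 : ℝ) ^ 2 / 2 ≤ ⟪u, u'⟫ ∧ T = {u, u'})
  (hBcard : B.card = 24)
  (hdeg : ∀ v ∈ X, ∃ w : Fin 4 → EuclideanSpace ℝ (Fin 3), (∀ k, w k ∈ X) ∧
    Function.Injective w ∧ (∀ k, w k ≠ v) ∧
    (∀ k, ({v, w k} : Finset (EuclideanSpace ℝ (Fin 3))) ∈ B) ∧
    ∀ y, ({v, y} : Finset (EuclideanSpace ℝ (Fin 3))) ∈ B → ∃ k, y = w k)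

include hT hX1 hcard hsepX hB hBcard hdeg in
open scoped Classical in
/-- **(E) The bond graph at one percent is the cuboctahedron or the anticuboctahedron**
(conditional on Tammes-13). -/
theorem bond_graph_fcc_or_hcp :
    ∃ p : Fin 12 → EuclideanSpace ℝ (Fin 3), Function.Injective p ∧ (∀ i, p i ∈ X) ∧
      ((∀ i j, ({p i, p j} : Finset (EuclideanSpace ℝ (Fin 3))) ∈ B ↔ fccAdj i j) ∨
       (∀ i j, ({p i, p j} : Finset (EuclideanSpace ℝ (Fin 3))) ∈ B ↔ hcpAdj i j)) := by
  by_cases hA : ∃ v ∈ X, ∃ a b c d : EuclideanSpace ℝ (Fin 3),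
      (∀ y, ({v, y} : Finset (EuclideanSpace ℝ (Fin 3))) ∈ B ↔ (y = a ∨ y = b ∨ y = c ∨ y = d)) ∧
      (a ≠ b ∧ a ≠ c ∧ a ≠ d ∧ b ≠ c ∧ b ≠ d ∧ c ≠ d) ∧
      ({a, b} : Finset (EuclideanSpace ℝ (Fin 3))) ∈ B ∧ ({b, c} : Finset (EuclideanSpace ℝ (Fin 3))) ∈ B ∧
      ({a, c} : Finset (EuclideanSpace ℝ (Fin 3))) ∉ B ∧ ({a, d} : Finset (EuclideanSpace ℝ (Fin 3))) ∉ B ∧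
      ({b, d} : Finset (EuclideanSpace ℝ (Fin 3))) ∉ B ∧ ({c, d} : Finset (EuclideanSpace ℝ (Fin 3))) ∉ B
  · ------------------------------------------------------------ a type-A vertex: HCP
    obtain ⟨v, hv, a, b, c, d, hN, hd, hab, hbc, hac, had, hbd, hcd⟩ := hA
    obtain ⟨e, b₃, b₄, a₃, c₃, a₄, c₄, hnd, hXeq, hNv, hNb4, hNd, hNe, hNb3, hNb, hNa3, hNa, hNa4, hNc3,
        hNc, hNc4⟩ :=
      hexagon_structure hT hX1 hcard hsepX hB hBcard hdeg hv hN hd hab hbc hac had hbd hcd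
    refine ⟨![v, b₄, d, e, b₃, b, a₃, a, a₄, c₃, c, c₄], injective_vec12 hnd, ?_, Or.inr ?_⟩
    · intro i
      rw [hXeq]
      fin_cases i <;> simp
    · exact labelling_hcp _ (injective_vec12 hnd)
        (fun t => (hNv t).trans ⟨by rintro (h | h | h | h); exacts [Or.inr (Or.inr (Or.inl h)), Or.inr (Or.inl h), Or.inr (Or.inr (Or.inr h)), Or.inl h], by rintro (h | h | h | h); exacts [Or.inr (Or.inr (Or.inr h)), Or.inr (Or.inl h), Or.inl h, Or.inr (Or.inr (Or.inl h))]⟩)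
        (fun t => (hNb4 t).trans ⟨by rintro (h | h | h | h); exacts [Or.inr (Or.inr (Or.inl h)), Or.inl h, Or.inr (Or.inr (Or.inr h)), Or.inr (Or.inl h)], by rintro (h | h | h | h); exacts [Or.inr (Or.inl h), Or.inr (Or.inr (Or.inr h)), Or.inl h, Or.inr (Or.inr (Or.inl h))]⟩)
        (fun t => (hNd t).trans ⟨by rintro (h | h | h | h); exacts [Or.inr (Or.inr (Or.inl h)), Or.inr (Or.inl h), Or.inr (Or.inr (Or.inr h)), Or.inl h], by rintro (h | h | h | h); exacts [Or.inr (Or.inr (Or.inr h)), Or.inr (Or.inl h), Or.inl h, Or.inr (Or.inr (Or.inl h))]⟩)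
        (fun t => (hNe t).trans ⟨by rintro (h | h | h | h); exacts [Or.inr (Or.inr (Or.inl h)), Or.inl h, Or.inr (Or.inr (Or.inr h)), Or.inr (Or.inl h)], by rintro (h | h | h | h); exacts [Or.inr (Or.inl h), Or.inr (Or.inr (Or.inr h)), Or.inl h, Or.inr (Or.inr (Or.inl h))]⟩)
        (fun t => (hNb3 t).trans ⟨by rintro (h | h | h | h); exacts [Or.inr (Or.inr (Or.inl h)), Or.inr (Or.inl h), Or.inr (Or.inr (Or.inr h)), Or.inl h], by rintro (h | h | h | h); exacts [Or.inr (Or.inr (Or.inr h)), Or.inr (Or.inl h), Or.inl h, Or.inr (Or.inr (Or.inl h))]⟩)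
        (fun t => (hNb t).trans ⟨by rintro (h | h | h | h); exacts [Or.inr (Or.inr (Or.inl h)), Or.inl h, Or.inr (Or.inr (Or.inr h)), Or.inr (Or.inl h)], by rintro (h | h | h | h); exacts [Or.inr (Or.inl h), Or.inr (Or.inr (Or.inr h)), Or.inl h, Or.inr (Or.inr (Or.inl h))]⟩)
        hNa3
        hNa
        (fun t => (hNa4 t).trans ⟨by rintro (h | h | h | h); exacts [Or.inr (Or.inl h), Or.inl h, Or.inr (Or.inr (Or.inr h)), Or.inr (Or.inr (Or.inl h))], by rintro (h | h | h | h); exacts [Or.inr (Or.inl h), Or.inl h, Or.inr (Or.inr (Or.inr h)), Or.inr (Or.inr (Or.inl h))]⟩)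
        hNc3
        hNc
        (fun t => (hNc4 t).trans ⟨by rintro (h | h | h | h); exacts [Or.inr (Or.inl h), Or.inl h, Or.inr (Or.inr (Or.inr h)), Or.inr (Or.inr (Or.inl h))], by rintro (h | h | h | h); exacts [Or.inr (Or.inl h), Or.inl h, Or.inr (Or.inr (Or.inr h)), Or.inr (Or.inr (Or.inl h))]⟩)
  · ------------------------------------------------------------ every vertex of type O: FCC
    have hallO : ∀ u ∈ X, ∃ a b c d : EuclideanSpace ℝ (Fin 3),
        (∀ t, ({u, t} : Finset (EuclideanSpace ℝ (Fin 3))) ∈ B ↔ (t = a ∨ t = b ∨ t = c ∨ t = d)) ∧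
        (a ≠ b ∧ a ≠ c ∧ a ≠ d ∧ b ≠ c ∧ b ≠ d ∧ c ≠ d) ∧
        ({a, b} : Finset (EuclideanSpace ℝ (Fin 3))) ∈ B ∧ ({c, d} : Finset (EuclideanSpace ℝ (Fin 3))) ∈ B ∧
        ({a, c} : Finset (EuclideanSpace ℝ (Fin 3))) ∉ B ∧ ({a, d} : Finset (EuclideanSpace ℝ (Fin 3))) ∉ B ∧
        ({b, c} : Finset (EuclideanSpace ℝ (Fin 3))) ∉ B ∧ ({b, d} : Finset (EuclideanSpace ℝ (Fin 3))) ∉ B := by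
      intro u hu
      rcases type_cases hT hX1 hcard hsepX hB hBcard hdeg hu with
        ⟨a, b, c, d, hN, hd, h1, h2, h3, h4, h5, h6⟩ | ⟨a, b, c, d, hN, hd, h1, h2, h3, h4, h5, h6⟩
      · exact absurd ⟨u, hu, a, b, c, d, hN, hd, h1, h2, h3, h4, h5, h6⟩ hA
      · exact ⟨a, b, c, d, hN, hd, h1, h2, h3, h4, h5, h6⟩
    obtain ⟨v, hv⟩ : X.Nonempty := by rw [← Finset.card_pos, hcard]; norm_num
    obtain ⟨a₀, b₀, c₀, d₀, hN₀, hd₀, hab₀, hcd₀, hac₀, had₀, hbc₀, hbd₀⟩ := hallO v hv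
    obtain ⟨x, y, z, a, c, b', d', b, d, a', c', hnd, hXeq, hNv, hNx, hNy, hNz, hNa, hNc, hNbp, hNdp, hNb,
        hNd, hNap, hNcp⟩ :=
      cube_structure hT hX1 hcard hsepX hB hBcard hdeg hallO hv hN₀ hd₀ hab₀ hcd₀ hac₀ had₀ hbc₀ hbd₀
    refine ⟨![v, x, y, z, a, c, b', d', b, d, a', c'], injective_vec12 hnd, ?_, Or.inl ?_⟩
    · intro i
      rw [hXeq]
      fin_cases i <;> simp
    · exact labelling_fcc _ (injective_vec12 hnd) hNv hNx hNy hNz hNa hNc hNbp hNdp hNb hNd hNap hNcp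

end Setting

end Summit.AtomisticToContinuum.Crystallization.Theorems
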